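import Literature.NumberTheory.QuadraticForms.HasseMinkowskiQuaternaryRat
import Literature.NumberTheory.QuadraticForms.HasseMinkowskiBinaryRat
import Literature.NumberTheory.QuadraticForms.HasseMinkowskiDiagonal
import Mathlib.NumberTheory.Padics.HeightOneSpectrum
import HarnessLib

/-!
# The Hasse–Minkowski theorem over `ℚ` from Meyer's theorem (assembly of Serre IV §3.2 Thm 8)

Topic `NumberTheory/QuadraticForms`; namespace `Literature.NumberTheory.QuadraticForms`. Everything
here is proved. The named fact `hasseMinkowski` (`HasseMinkowski.lean`: Serre, *A Course in
Arithmetic*, Ch. IV §3.2 Thm 8, for arbitrary nondegenerate symmetric matrices over `ℚ`, with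
local hypotheses in Mathlib's `ℚ_[p]` and `ℝ`) is assembled from its rank cases, following Serre's
case distinction `n = 2, 3, 4, ≥ 5` (PDF pp. 39–41), conditionally on the named fact `meyer`
for the ranks `≥ 5`:

* `n ≤ 1`: no non-trivial real zero exists (vacuous);
* `n = 2`: `exists_binary_zero_rat` (`HasseMinkowskiBinaryRat.lean`, global squares);
* `n = 3`: Legendre's theorem, `exists_ternary_zero_rat_of_odd_places`
  (`HasseMinkowskiTernaryRat.lean`), the zeros in `ℚ_[p]` being transported to the completions
  `v.adicCompletion ℚ` along Mathlib's `adicCompletion.padicEquiv`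
  (`exists_ringEquiv_padic_adicCompletion`);
* `n = 4`: `exists_quaternary_zero_rat` (`HasseMinkowskiQuaternaryRat.lean`, Dirichlet's
  theorem), same transport;
* `n ≥ 5`: a real zero forces coefficients of both signs (`exists_pos_and_neg_of_real_zero`),
  and `meyer` applies to the diagonal matrix — the converse half of Serre's Cor. 2
  ("`f` represents `0` iff it is indefinite") read as a case of Thm 8.

Main result: `hasseMinkowski_of_meyer : meyer → hasseMinkowski` (via
`hasseMinkowski_of_diagonal`). With `meyer_of_quinaryHasseMinkowskiRat` (`MeyerOfQuinary.lean`)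
both named facts thus reduce to the single rank-`5` case of Thm 8.

## References

* J.-P. Serre, *A Course in Arithmetic*, GTM 7, Springer 1973, Ch. IV §3.2 Thm 8 and Cor. 2
  (PDF pp. 39–41). [Serre1973]
-/

noncomputable section

namespace Literature.NumberTheory.QuadraticForms

open IsDedekindDomain NumberField Rat.HeightOneSpectrum Finset

/-! ### From `ℚ_[p]` to the completion `ℚ_v` at the place over `p` -/

/-- The prime `primesEquiv v` under a finite place `v` of `ℚ` is prime, as a `Fact` (for
`ℚ_[primesEquiv v]`; `(primesEquiv v : ℕ) = natGenerator v` by `rfl`). [folklore] -/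
theorem fact_prime_primesEquiv (v : HeightOneSpectrum (𝓞 ℚ)) :
    Fact (primesEquiv (R := 𝓞 ℚ) v : ℕ).Prime :=
  ⟨(primesEquiv (R := 𝓞 ℚ) v).2⟩

attribute [local instance] fact_prime_primesEquiv

/-- **`ℚ_p ≅ ℚ_v`** for the finite place `v` of `ℚ` over `p = primesEquiv v`, compatibly with
`ℚ` (Mathlib's `adicCompletion.padicEquiv`, reversed): a ring isomorphism
`ℚ_[p] ≃+* v.adicCompletion ℚ` sending `(q : ℚ_[p])` to `algebraMap ℚ ℚ_v q`. [folklore] -/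
theorem exists_ringEquiv_padic_adicCompletion (v : HeightOneSpectrum (𝓞 ℚ)) :
    ∃ e : ℚ_[(primesEquiv (R := 𝓞 ℚ) v : ℕ)] ≃+* v.adicCompletion ℚ,
      ∀ q : ℚ, e (q : ℚ_[(primesEquiv (R := 𝓞 ℚ) v : ℕ)]) = algebraMap ℚ (v.adicCompletion ℚ) q := by
  let e := (adicCompletion.padicEquiv (R := 𝓞 ℚ) v).toAlgEquiv
  exact ⟨e.symm.toRingEquiv, fun q => by simp⟩

/-- **Transport of zeros of a rational diagonal form from `ℚ_[p]` to `ℚ_v`**, `v ∣ p`.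
[folklore] -/
theorem exists_zero_adicCompletion_of_padic (v : HeightOneSpectrum (𝓞 ℚ)) {n : ℕ} (c : Fin n → ℚ)
    (h : ∃ x : Fin n → ℚ_[(primesEquiv (R := 𝓞 ℚ) v : ℕ)], x ≠ 0 ∧
      ∑ i, (c i : ℚ_[(primesEquiv (R := 𝓞 ℚ) v : ℕ)]) * x i ^ 2 = 0) :
    ∃ y : Fin n → v.adicCompletion ℚ, y ≠ 0 ∧
      ∑ i, algebraMap ℚ (v.adicCompletion ℚ) (c i) * y i ^ 2 = 0 := by
  obtain ⟨e, he⟩ := exists_ringEquiv_padic_adicCompletion v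
  obtain ⟨x, hx0, hx⟩ := h
  refine ⟨fun i => e (x i), fun h0 => hx0 (funext fun i => ?_), ?_⟩
  · have := congr_fun h0 i
    simpa using this
  · have := congrArg e hx
    rw [map_sum, map_zero] at this
    simpa only [map_mul, map_pow, he] using this

/-! ### The real place: a real zero forces both signs -/

/-- **A non-trivial real zero of `∑ cᵢ xᵢ²` (`cᵢ ∈ ℚ^*`) forces coefficients of both signs**:
if all `cᵢ > 0` (resp. `< 0`) the form is positive (resp. negative) on non-zero real vectors
(Serre, Ch. IV §2.4: a definite form does not represent `0`). [cite: Serre1973, Ch. IV §2.4] -/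
theorem exists_pos_and_neg_of_real_zero {n : ℕ} {c : Fin n → ℚ} (hc : ∀ i, c i ≠ 0)
    (h : ∃ x : Fin n → ℝ, x ≠ 0 ∧ ∑ i, (c i : ℝ) * x i ^ 2 = 0) :
    (∃ i, 0 < c i) ∧ ∃ j, c j < 0 := by
  obtain ⟨x, hx0, hx⟩ := h
  obtain ⟨k, hk⟩ : ∃ k, x k ≠ 0 := Function.ne_iff.mp hx0
  have hxk : 0 < x k ^ 2 := by positivity
  constructor
  · by_contra hall
    push Not at hall
    have hneg : ∀ i, c i < 0 := fun i => lt_of_le_of_ne (hall i) (hc i)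
    have : ∑ i, (c i : ℝ) * x i ^ 2 < 0 := by
      refine (Finset.sum_lt_sum (fun i _ => mul_nonpos_of_nonpos_of_nonneg
        (by exact_mod_cast (hneg i).le) (sq_nonneg _)) ⟨k, Finset.mem_univ k, ?_⟩).trans_eq
        (by simp)
      exact mul_neg_of_neg_of_pos (by exact_mod_cast hneg k) hxk
    linarith
  · by_contra hall
    push Not at hall
    have hpos : ∀ i, 0 < c i := fun i => lt_of_le_of_ne (hall i) (hc i).symm
    have : 0 < ∑ i, (c i : ℝ) * x i ^ 2 := by
      refine (Finset.sum_lt_sum (fun i _ => mul_nonneg (by exact_mod_cast (hpos i).le)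
        (sq_nonneg _)) ⟨k, Finset.mem_univ k, ?_⟩).trans_eq' (by simp)
      exact mul_pos (by exact_mod_cast hpos k) hxk
    linarith

/-! ### The rank cases -/

/-- **Ranks `0` and `1` are vacuous**: a diagonal form `∑ cᵢxᵢ²` with `cᵢ ≠ 0` in at most one
variable has no non-trivial real zero. [folklore] -/
theorem not_exists_real_zero_of_le_one {n : ℕ} (hn : n ≤ 1) {c : Fin n → ℚ} (hc : ∀ i, c i ≠ 0) :
    ¬ ∃ x : Fin n → ℝ, x ≠ 0 ∧ ∑ i, (c i : ℝ) * x i ^ 2 = 0 := by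
  intro h
  obtain ⟨⟨i, hi⟩, ⟨j, hj⟩⟩ := exists_pos_and_neg_of_real_zero hc h
  have : i = j := Fin.ext (by omega)
  subst this
  exact lt_asymm hi hj

/-- **Rank `3` (Legendre's theorem)** in the format of `hasseMinkowski_of_diagonal`: from
`exists_ternary_zero_rat_of_odd_places` (Serre Ch. IV §3.2 Thm 8 (ii)), with `a = -c₀/c₂`,
`b = -c₁/c₂`, the zeros in `ℚ_[p]` transported to the completions and the real zero giving
`a > 0 ∨ b > 0`. [cite: Serre1973, Ch. IV §3.2 Thm 8 (ii)] -/
theorem exists_ternary_zero_rat_padic (c : Fin 3 → ℚ) (hc : ∀ i, c i ≠ 0)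
    (hR : ∃ x : Fin 3 → ℝ, x ≠ 0 ∧ ∑ i, (c i : ℝ) * x i ^ 2 = 0)
    (hP : ∀ (p : ℕ) [Fact p.Prime], ∃ x : Fin 3 → ℚ_[p], x ≠ 0 ∧ ∑ i, (c i : ℚ_[p]) * x i ^ 2 = 0) :
    ∃ x : Fin 3 → ℚ, x ≠ 0 ∧ ∑ i, c i * x i ^ 2 = 0 := by
  set a : ℚ := -c 0 / c 2 with ha_def
  set b : ℚ := -c 1 / c 2 with hb_def
  have ha : a ≠ 0 := div_ne_zero (neg_ne_zero.mpr (hc 0)) (hc 2)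
  have hb : b ≠ 0 := div_ne_zero (neg_ne_zero.mpr (hc 1)) (hc 2)
  -- a zero of `∑ cᵢxᵢ²` over a field `F ⊇ ℚ` is a zero of `Z² - aX² - bY²`
  have key : ∀ {F : Type} [Field F] (φ : ℚ →+* F) (x : Fin 3 → F),
      ∑ i, φ (c i) * x i ^ 2 = 0 → x 2 ^ 2 - φ a * x 0 ^ 2 - φ b * x 1 ^ 2 = 0 := by
    intro F _ φ x hx
    rw [Fin.sum_univ_three] at hx
    have hc2 : φ (c 2) ≠ 0 := (map_ne_zero φ).mpr (hc 2)
    rw [ha_def, hb_def, map_div₀, map_div₀, map_neg, map_neg]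
    field_simp
    linear_combination hx
  have hne : ∀ {F : Type} [Field F] (x : Fin 3 → F), x ≠ 0 → x 0 ≠ 0 ∨ x 1 ≠ 0 ∨ x 2 ≠ 0 := by
    intro F _ x hx
    by_contra hn
    push Not at hn
    exact hx (funext fun i => by fin_cases i <;> simp [hn.1, hn.2.1, hn.2.2])
  -- the real place: `a > 0 ∨ b > 0`
  have hinf : 0 < a ∨ 0 < b := by
    obtain ⟨x, hx0, hx⟩ := hR
    have h := key (Rat.castHom ℝ) x (by simpa using hx)
    simp only [Rat.coe_castHom] at h
    by_contra hcon
    push Not at hcon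
    have ha' : (a : ℝ) < 0 := by exact_mod_cast lt_of_le_of_ne hcon.1 ha
    have hb' : (b : ℝ) < 0 := by exact_mod_cast lt_of_le_of_ne hcon.2 hb
    have h1 : (a : ℝ) * x 0 ^ 2 ≤ 0 := mul_nonpos_of_nonpos_of_nonneg ha'.le (sq_nonneg _)
    have h2 : (b : ℝ) * x 1 ^ 2 ≤ 0 := mul_nonpos_of_nonpos_of_nonneg hb'.le (sq_nonneg _)
    have h3 : 0 ≤ x 2 ^ 2 := sq_nonneg _
    have hz : x 2 = 0 := by nlinarith
    have hx0' : x 0 = 0 := by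
      by_contra h0
      have : (a : ℝ) * x 0 ^ 2 < 0 := mul_neg_of_neg_of_pos ha' (by positivity)
      nlinarith
    have hx1' : x 1 = 0 := by
      by_contra h0
      have : (b : ℝ) * x 1 ^ 2 < 0 := mul_neg_of_neg_of_pos hb' (by positivity)
      nlinarith
    rcases hne x hx0 with h0 | h0 | h0 <;> contradiction
  -- the finite places
  have hloc : ∀ v : HeightOneSpectrum (𝓞 ℚ), natGenerator v ≠ 2 →
      ∃ x y z : v.adicCompletion ℚ, (x ≠ 0 ∨ y ≠ 0 ∨ z ≠ 0) ∧
        z ^ 2 - algebraMap ℚ _ a * x ^ 2 - algebraMap ℚ _ b * y ^ 2 = 0 := by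
    intro v _
    obtain ⟨y, hy0, hy⟩ := exists_zero_adicCompletion_of_padic v c (hP _)
    exact ⟨y 0, y 1, y 2, hne y hy0, key (algebraMap ℚ _) y hy⟩
  obtain ⟨x, y, z, hz, h⟩ := exists_ternary_zero_rat_of_odd_places ha hb hloc hinf
  refine ⟨![x, y, z], fun h0 => hz (by simpa using congr_fun h0 2), ?_⟩
  rw [Fin.sum_univ_three]
  simp only [Matrix.cons_val_zero, Matrix.cons_val_one, Matrix.cons_val]
  have hc2 : c 2 ≠ 0 := hc 2
  rw [ha_def, hb_def] at h
  field_simp at h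
  linear_combination h

/-- **Rank `4` (Dirichlet)** in the format of `hasseMinkowski_of_diagonal`: from
`exists_quaternary_zero_rat` (Serre Ch. IV §3.2 Thm 8 (iii)), transporting the zeros in `ℚ_[p]`
to the completions, the sign conditions coming from the real zero.
[cite: Serre1973, Ch. IV §3.2 Thm 8 (iii)] -/
theorem exists_quaternary_zero_rat_padic (c : Fin 4 → ℚ) (hc : ∀ i, c i ≠ 0)
    (hR : ∃ x : Fin 4 → ℝ, x ≠ 0 ∧ ∑ i, (c i : ℝ) * x i ^ 2 = 0)
    (hP : ∀ (p : ℕ) [Fact p.Prime], ∃ x : Fin 4 → ℚ_[p], x ≠ 0 ∧ ∑ i, (c i : ℚ_[p]) * x i ^ 2 = 0) :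
    ∃ x : Fin 4 → ℚ, x ≠ 0 ∧ ∑ i, c i * x i ^ 2 = 0 := by
  obtain ⟨⟨i, hi⟩, ⟨j, hj⟩⟩ := exists_pos_and_neg_of_real_zero hc hR
  have hloc : ∀ v : HeightOneSpectrum (𝓞 ℚ), ∃ x : Fin 4 → v.adicCompletion ℚ, x ≠ 0 ∧
      algebraMap ℚ _ (c 0) * x 0 ^ 2 + algebraMap ℚ _ (c 1) * x 1 ^ 2 +
        algebraMap ℚ _ (c 2) * x 2 ^ 2 + algebraMap ℚ _ (c 3) * x 3 ^ 2 = 0 := by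
    intro v
    obtain ⟨y, hy0, hy⟩ := exists_zero_adicCompletion_of_padic v c (hP _)
    exact ⟨y, hy0, by rw [Fin.sum_univ_four] at hy; exact hy⟩
  obtain ⟨x, hx0, hx⟩ := exists_quaternary_zero_rat (hc 0) (hc 1) (hc 2) (hc 3) hloc
    (fun h => by
      have : ∀ k, 0 < c k := fun k => by fin_cases k <;> tauto
      exact lt_asymm hj (this j))
    (fun h => by
      have : ∀ k, c k < 0 := fun k => by fin_cases k <;> tauto
      exact lt_asymm hi (this i))
  exact ⟨x, hx0, by rw [Fin.sum_univ_four]; exact hx⟩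

/-- **Rank `≥ 5` from Meyer's theorem**: a diagonal form of rank `n ≥ 5` with a non-trivial real
zero has coefficients of both signs, hence (the named fact `meyer`, Serre Ch. IV §3.2 Cor. 2) a
non-trivial rational zero. [cite: Serre1973, Ch. IV §3.2 Cor. 2] -/
theorem exists_zero_rat_of_meyer (hM : meyer) {n : ℕ} (hn : 5 ≤ n) (c : Fin n → ℚ)
    (hc : ∀ i, c i ≠ 0) (hR : ∃ x : Fin n → ℝ, x ≠ 0 ∧ ∑ i, (c i : ℝ) * x i ^ 2 = 0) :
    ∃ x : Fin n → ℚ, x ≠ 0 ∧ ∑ i, c i * x i ^ 2 = 0 := by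
  classical
  obtain ⟨⟨i, hi⟩, ⟨j, hj⟩⟩ := exists_pos_and_neg_of_real_zero hc hR
  have hsingle : ∀ k, Matrix.toBilin' (Matrix.diagonal c) (Pi.single k 1) (Pi.single k 1) = c k := by
    intro k
    rw [toBilin'_diagonal_apply, Finset.sum_eq_single k]
    · simp
    · intro l _ hlk
      simp [Pi.single_eq_of_ne hlk]
    · intro hk
      exact absurd (Finset.mem_univ k) hk
  obtain ⟨x, hx0, hx⟩ := hM (Matrix.diagonal c) hn (Matrix.isSymm_diagonal c)
    (by rw [Matrix.det_diagonal]; exact Finset.prod_ne_zero_iff.mpr fun k _ => hc k)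
    ⟨Pi.single i 1, by rw [hsingle]; exact hi⟩ ⟨Pi.single j 1, by rw [hsingle]; exact hj⟩
  exact ⟨x, hx0, by rwa [toBilin'_diagonal_apply] at hx⟩

/-! ### Assembly -/

/-- **The Hasse–Minkowski theorem from Meyer's theorem**: `meyer → hasseMinkowski` (Serre,
*A Course in Arithmetic*, Ch. IV §3.2 Thm 8, by the cases `n = 2, 3, 4, ≥ 5` of its proof, the
first three unconditionally — `exists_binary_zero_rat`, Legendre `exists_ternary_zero_rat_padic`,
Dirichlet `exists_quaternary_zero_rat_padic` — and the last by the named fact `meyer`, Cor. 2,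
itself the case `n = 5` of Thm 8 together with Thm 6 (iv)). Together with
`meyer_of_quinaryHasseMinkowskiRat`, both named facts reduce to Thm 8 for `n = 5`.
[cite: Serre1973, Ch. IV §3.2 Thm 8] -/
theorem hasseMinkowski_of_meyer (hM : meyer) : hasseMinkowski := by
  refine hasseMinkowski_of_diagonal fun n c hc hR hP => ?_
  rcases Nat.lt_or_ge n 5 with hn | hn
  · interval_cases n
    · exact absurd hR (not_exists_real_zero_of_le_one (by norm_num) hc)
    · exact absurd hR (not_exists_real_zero_of_le_one (by norm_num) hc)
    · exact exists_binary_zero_rat c hc hR hP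
    · exact exists_ternary_zero_rat_padic c hc hR hP
    · exact exists_quaternary_zero_rat_padic c hc hR hP
  · exact exists_zero_rat_of_meyer hM hn c hc hR

end Literature.NumberTheory.QuadraticForms
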